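import Summits.HodgeConjecture.HodgeConjecture.Theorems.TropicalKugaSatakeCayleyKontsevichTransferKSGenericMemberStructure
import Summits.HodgeConjecture.HodgeConjecture.Theorems.TropicalKugaSatakeCayleyFormalCycleCriterionFormalFamily
import Mathlib

/-!
# Route `TropicalKugaSatakeCayley`, crux K2 `KontsevichTransferKS` (stmt-HodgeConjecture-18570), line `birth`:
# the VERY GENERAL member of the Kuga–Satake family is Hodge-generic — part 2: analyticity, Baire,
# and the form-level theorem

The load-bearing stub `stub_kontsevichShadow` of the skeleton
`Cruxes/KontsevichTransferKS/Lines/birth.lean` asks for a point `z` of the tube domain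
`T = {z ∈ ℂ⁵ | Im z ∈ ksPosCone}` with two properties; its clause (i), HODGE-GENERICITY, is "the
constant form of every algebraic class of every model of `ℂ⁸/(ℤ⁸ ⊕ τ(z)ℤ⁸)` is a flat Hodge form"
(of type `(6,6)` on EVERY member, through every Kuga–Satake period map). This file proves the
form-level heart of clause (i), for all degrees at once:

* `kontsevichTransferKS_exists_genericMember_forms` — **in every open subset of `ℂ⁵` meeting `T`
  there is `z₀ ∈ T` such that every constant alternating form `ω` on `Λ_ℝ = ℝ⁸ ⊕ ℝ⁸` of degree
  `k = 2p` with RATIONAL values on the standard basis tuples which is of type `(p,p)` through a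
  Kuga–Satake period map of `z₀` is of type `(p,p)` through every Kuga–Satake period map of every
  point of `T`** (very general members are Hodge-generic: Lange–Birkenhake §17.1; the Hodge-generic
  classes of this family are van Geemen–Verra's flat classes, §6.1).

Mechanism (no Mumford–Tate groups needed):
* §1 the complex structure `J_z = Φ⁻¹ ∘ i ∘ Φ` of the member `z` (`tkc_J_apply`) has its
  denominator cleared by the scalar `D(Im z) = a² − q` of the Clifford inverse formula
  `B_t⁻¹ = D(t)⁻¹ (a·1 − X) B₁⁻¹` (`tkc_ksMatrix_inv`): `J_z = D⁻¹ N_z` with `N_z w` POLYNOMIAL in the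
  ten real coordinates of `z` (`kgmJnum`, `kgm_J_eq`);
* §2 type `(p,p)` through `Φ` ⟺ the cleared derivation `F_ω(z; w) = Σₘ ω(…, N_z wₘ, …)` vanishes for
  all `w` (rotation invariance differentiates to `D_J ω = 0`, `ktks_sum_update_eq_zero_of_rotation`,
  and integrates back, `tkc_rotation_of_deriv_zero`) (`kgm_isConstOfType_iff`);
* §3 `F_ω(z; ·)` is multilinear, so basis tuples suffice (`Module.Basis.ext_multilinear`);
* §4 `z ↦ F_ω(z; w)` is real-analytic on `ℂ⁵` (sums and products of coordinates);
* §5 for the countably many pairs (rational `ω`, basis tuple) the set where "`F` vanishes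
  identically or `F(z) ≠ 0`" is open and dense (identity principle for real-analytic functions on
  the connected `ℂ⁵`), so their intersection is dense (Baire);
* §6 at such a `z₀ ∈ T`, type `(p,p)` forces every `F_ω(·; e_b)` to vanish at `z₀`, hence
  identically, hence type `(p,p)` everywhere.

THIS PART: §4–§6 (part 1 `…GenericMemberStructure`: §1–§3; part 3 `…GenericMemberClasses`: the
passage from classes on a model to constant forms, clause (i) proper). Definitions introduced
(bookkeeping only, all explicit): `kgmRatForms`, `KgmIndex`, `kgmTest`, `kgmGood`. No named fact, no
sorry.

## References

* [vanGeemenVerra2003QuaternionicPryms] B. van Geemen, A. Verra, Quaternionic Pryms and Hodge classes,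
  Topology 42 (2003), §6.1, Rem. 6.6.
* [LangeBirkenhake1992] H. Lange, Ch. Birkenhake, Complex Abelian Varieties (1992), §1.1.5, §8.1,
  §17.1.
* [BochnakCosteRoy1998] J. Bochnak, M. Coste, M.-F. Roy, Real Algebraic Geometry (1998), §2.8 (zero
  sets of polynomials are thin).
-/

noncomputable section

set_option linter.dupNamespace false

namespace Summit.HodgeConjecture.HodgeConjecture.Theorems

open Literature.AlgebraicGeometry.Tropical Literature.AlgebraicGeometry.Tropical.TropicalTorus
open Literature.Geometry.Kaehler
open scoped Matrix

/-! ### §4 The cleared derivation is a real-analytic (polynomial) function of `z` -/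

section Analytic

/-- The real coordinates `z ↦ Re z_k`, `z ↦ Im z_k` are real-analytic on `ℂ⁵`. [folklore] -/
theorem kgm_analyticAt_re (l : Fin 5) (z₀ : Fin 5 → ℂ) :
    AnalyticAt ℝ (fun z : Fin 5 → ℂ => (z l).re) z₀ :=
  ((Complex.reCLM.comp ((ContinuousLinearMap.proj (R := ℂ) (φ := fun _ : Fin 5 => ℂ) l).restrictScalars ℝ))).analyticAt z₀

/-- See `kgm_analyticAt_re`. [folklore] -/
theorem kgm_analyticAt_im (l : Fin 5) (z₀ : Fin 5 → ℂ) :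
    AnalyticAt ℝ (fun z : Fin 5 → ℂ => (z l).im) z₀ :=
  ((Complex.imCLM.comp ((ContinuousLinearMap.proj (R := ℂ) (φ := fun _ : Fin 5 => ℂ) l).restrictScalars ℝ))).analyticAt z₀

/-- Entries of `B_(c(z))` are analytic in `z` when the parameter `c(z)` is. [folklore] -/
theorem kgm_analyticAt_ksMatrix_entry {c : (Fin 5 → ℂ) → (Fin 5 → ℝ)} {z₀ : Fin 5 → ℂ}
    (hc : ∀ l, AnalyticAt ℝ (fun z => c z l) z₀) (i j : Fin 8) :
    AnalyticAt ℝ (fun z => ksMatrix (c z) i j) z₀ := by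
  simp only [ksMatrix_apply]
  exact Finset.analyticAt_fun_sum _ fun l _ => (hc l).mul analyticAt_const

/-- Components of `M(z) *ᵥ u(z)` are analytic when the entries of `M` and the components of `u` are.
[folklore] -/
theorem kgm_analyticAt_mulVec {M : (Fin 5 → ℂ) → Matrix (Fin 8) (Fin 8) ℝ}
    {u : (Fin 5 → ℂ) → (Fin 8 → ℝ)} {z₀ : Fin 5 → ℂ}
    (hM : ∀ i j, AnalyticAt ℝ (fun z => M z i j) z₀) (hu : ∀ j, AnalyticAt ℝ (fun z => u z j) z₀)
    (i : Fin 8) : AnalyticAt ℝ (fun z => (M z *ᵥ u z) i) z₀ := by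
  simp only [Matrix.mulVec, dotProduct]
  exact Finset.analyticAt_fun_sum _ fun j _ => (hM i j).mul (hu j)

/-- The denominator `D(Im z)` is analytic in `z`. [folklore] -/
theorem kgm_analyticAt_den (z₀ : Fin 5 → ℂ) :
    AnalyticAt ℝ (fun z : Fin 5 → ℂ => kgmDen (fun k => (z k).im)) z₀ := by
  unfold kgmDen
  refine AnalyticAt.sub ?_ ?_
  · exact ((kgm_analyticAt_im 0 z₀).add
      (analyticAt_const.mul (Finset.analyticAt_fun_sum _ fun l _ => kgm_analyticAt_im _ z₀))).pow 2
  · exact Finset.analyticAt_fun_sum _ fun l _ =>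
      analyticAt_const.mul ((kgm_analyticAt_im _ z₀).pow 2)

/-- Entries of the numerator `M(Im z)` are analytic in `z`. [folklore] -/
theorem kgm_analyticAt_invNum_entry (z₀ : Fin 5 → ℂ) (i j : Fin 8) :
    AnalyticAt ℝ (fun z : Fin 5 → ℂ => kgmInvNum (fun k => (z k).im) i j) z₀ := by
  unfold kgmInvNum
  simp only [Matrix.mul_apply, Matrix.sub_apply, Matrix.smul_apply, Matrix.sum_apply, smul_eq_mul]
  refine Finset.analyticAt_fun_sum _ fun m _ => AnalyticAt.mul ?_ analyticAt_const
  refine AnalyticAt.sub ?_ ?_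
  · exact ((kgm_analyticAt_im 0 z₀).add
      (analyticAt_const.mul (Finset.analyticAt_fun_sum _ fun l _ => kgm_analyticAt_im _ z₀))).mul
      analyticAt_const
  · exact Finset.analyticAt_fun_sum _ fun l _ => (kgm_analyticAt_im _ z₀).mul analyticAt_const

/-- Components of the cleared complex structure `N_z w` are analytic in `z`. [folklore] -/
theorem kgm_analyticAt_Jnum (w : Fin 8 ⊕ Fin 8 → ℝ) (z₀ : Fin 5 → ℂ) (i : Fin 8 ⊕ Fin 8) :
    AnalyticAt ℝ (fun z : Fin 5 → ℂ => kgmJnum z w i) z₀ := by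
  -- the inner vector `v(z) = M (x + R y)` is analytic componentwise
  have hRy : ∀ j, AnalyticAt ℝ
      (fun z : Fin 5 → ℂ => (ksMatrix (fun k => (z k).re) *ᵥ fun j => w (Sum.inr j)) j) z₀ :=
    fun j => kgm_analyticAt_mulVec (u := fun _ => fun j => w (Sum.inr j))
      (fun i j => kgm_analyticAt_ksMatrix_entry (fun l => kgm_analyticAt_re l z₀) i j)
      (fun _ => analyticAt_const) j
  have hxRy : ∀ j, AnalyticAt ℝ (fun z : Fin 5 → ℂ =>
      ((fun i => w (Sum.inl i)) + ksMatrix (fun k => (z k).re) *ᵥ fun j => w (Sum.inr j)) j) z₀ :=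
    fun j => by
      simp only [Pi.add_apply]
      exact analyticAt_const.add (hRy j)
  have hv : ∀ j, AnalyticAt ℝ (fun z : Fin 5 → ℂ => (kgmInvNum (fun k => (z k).im) *ᵥ
      ((fun i => w (Sum.inl i)) + ksMatrix (fun k => (z k).re) *ᵥ fun j => w (Sum.inr j))) j) z₀ :=
    fun j => kgm_analyticAt_mulVec (fun i j => kgm_analyticAt_invNum_entry z₀ i j) hxRy j
  rcases i with i | i
  · simp only [kgmJnum, Sum.elim_inl, Pi.sub_apply, Pi.neg_apply, Pi.smul_apply, smul_eq_mul]
    refine (((kgm_analyticAt_den z₀).mul ?_).neg).sub ?_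
    · exact kgm_analyticAt_mulVec (u := fun _ => fun j => w (Sum.inr j))
        (fun i j => kgm_analyticAt_ksMatrix_entry (fun l => kgm_analyticAt_im l z₀) i j)
        (fun _ => analyticAt_const) i
    · exact kgm_analyticAt_mulVec (fun i j => kgm_analyticAt_ksMatrix_entry
        (fun l => kgm_analyticAt_re l z₀) i j) hv i
  · simp only [kgmJnum, Sum.elim_inr]
    exact hv i

/-- `z ↦ N_z w` is analytic as a vector-valued map. [folklore] -/
theorem kgm_analyticAt_Jnum_pi (w : Fin 8 ⊕ Fin 8 → ℝ) (z₀ : Fin 5 → ℂ) :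
    AnalyticAt ℝ (fun z : Fin 5 → ℂ => kgmJnum z w) z₀ :=
  analyticAt_pi_iff.2 fun i => kgm_analyticAt_Jnum w z₀ i

/-- **The cleared derivation `z ↦ F_ω(z; w)` is real-analytic on all of `ℂ⁵`** (a polynomial in the
ten real coordinates). [folklore] -/
theorem kgm_analyticOnNhd_deriv {k : ℕ} (ω : (Fin 8 ⊕ Fin 8 → ℝ) [⋀^Fin k]→L[ℝ] ℂ)
    (w : Fin k → (Fin 8 ⊕ Fin 8 → ℝ)) :
    AnalyticOnNhd ℝ (fun z : Fin 5 → ℂ => kgmDeriv ω z w) Set.univ := by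
  classical
  intro z₀ _
  unfold kgmDeriv
  refine Finset.analyticAt_fun_sum _ fun m _ => ?_
  have h : AnalyticAt ℝ (fun z : Fin 5 → ℂ => (ω.toContinuousLinearMap w m) (kgmJnum z (w m))) z₀ :=
    ((ω.toContinuousLinearMap w m).analyticAt (kgmJnum z₀ (w m))).comp
      (f := fun z : Fin 5 → ℂ => kgmJnum z (w m)) (kgm_analyticAt_Jnum_pi (w m) z₀)
  simpa only [ContinuousAlternatingMap.toContinuousLinearMap_apply] using h

end Analytic

/-! ### §5 Baire: very general points of the tube domain -/

section Baire

/-- Rational constant forms on `Λ_ℝ`: rational values on all tuples of standard basis vectors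
(a countable set). [folklore] -/
def kgmRatForms (k : ℕ) : Set ((Fin 8 ⊕ Fin 8 → ℝ) [⋀^Fin k]→L[ℝ] ℂ) :=
  {ω | ∀ v : Fin k → Fin 8 ⊕ Fin 8, ω (fun j => Pi.single (v j) (1 : ℝ)) ∈ Set.range (algebraMap ℚ ℂ)}

/-- A constant form is determined by its values on tuples of standard basis vectors. [folklore] -/
theorem kgm_form_eq_of_basis {k : ℕ} {ω ω' : (Fin 8 ⊕ Fin 8 → ℝ) [⋀^Fin k]→L[ℝ] ℂ}
    (h : ∀ v : Fin k → Fin 8 ⊕ Fin 8,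
      ω (fun j => Pi.single (v j) (1 : ℝ)) = ω' (fun j => Pi.single (v j) (1 : ℝ))) : ω = ω' := by
  have hM : ω.toContinuousMultilinearMap.toMultilinearMap =
      ω'.toContinuousMultilinearMap.toMultilinearMap :=
    Module.Basis.ext_multilinear (fun _ => Pi.basisFun ℝ (Fin 8 ⊕ Fin 8)) fun v => by
      simp only [Pi.basisFun_apply]
      exact h v
  ext w
  exact DFunLike.congr_fun hM w

/-- The rational constant forms are countable. [folklore] -/
theorem kgm_countable_ratForms (k : ℕ) : (kgmRatForms k).Countable := by
  classical
  rw [Set.countable_coe_iff.symm]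
  let g : kgmRatForms k → ((Fin k → Fin 8 ⊕ Fin 8) → ℚ) :=
    fun ω v => Classical.choose (ω.2 v)
  have hg : ∀ (ω : kgmRatForms k) v,
      (algebraMap ℚ ℂ) (g ω v) = ω.1 (fun j => Pi.single (v j) (1 : ℝ)) :=
    fun ω v => Classical.choose_spec (ω.2 v)
  refine (Function.Injective.countable (f := g) fun ω ω' hωω' => ?_)
  apply Subtype.ext
  refine kgm_form_eq_of_basis fun v => ?_
  rw [← hg ω v, ← hg ω' v, hωω']

/-- The countable index of the Baire argument: a degree, a rational form, a basis tuple. [folklore] -/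
def KgmIndex : Type := Σ k : ℕ, (kgmRatForms k × (Fin k → Fin 8 ⊕ Fin 8))

/-- The index of the Baire argument is countable (rational forms are countable). [folklore] -/
instance : Countable KgmIndex := by
  haveI : ∀ k, Countable (kgmRatForms k) := fun k => (kgm_countable_ratForms k).to_subtype
  unfold KgmIndex
  infer_instance

/-- The test function of an index: `z ↦ F_ω(z; e_b)`. [folklore] -/
def kgmTest (i : KgmIndex) (z : Fin 5 → ℂ) : ℂ :=
  kgmDeriv i.2.1.1 z (fun m => Pi.single (i.2.2 m) (1 : ℝ))

/-- The good set of an index: everything if the test function vanishes identically, its non-vanishing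
locus otherwise; open and dense (identity principle for real-analytic functions). [folklore] -/
def kgmGood (i : KgmIndex) : Set (Fin 5 → ℂ) :=
  {z | (∀ z', kgmTest i z' = 0) ∨ kgmTest i z ≠ 0}

/-- The test functions are analytic. [folklore] -/
theorem kgm_analyticOnNhd_test (i : KgmIndex) : AnalyticOnNhd ℝ (kgmTest i) Set.univ :=
  kgm_analyticOnNhd_deriv _ _

/-- The good sets are open. [folklore] -/
theorem kgm_isOpen_good (i : KgmIndex) : IsOpen (kgmGood i) := by
  by_cases h : ∀ z', kgmTest i z' = 0
  · have : kgmGood i = Set.univ := Set.eq_univ_of_forall fun z => Or.inl h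
    rw [this]
    exact isOpen_univ
  · have : kgmGood i = {z | kgmTest i z ≠ 0} := by
      ext z
      simp only [kgmGood, Set.mem_setOf_eq, h, false_or]
    rw [this]
    exact isOpen_ne_fun (kgm_analyticOnNhd_test i).continuous continuous_const

/-- The good sets are dense: the zero set of a not identically vanishing real-analytic function on the
connected space `ℂ⁵` has empty interior. [folklore] -/
theorem kgm_dense_good (i : KgmIndex) : Dense (kgmGood i) := by
  by_cases h : ∀ z', kgmTest i z' = 0
  · have : kgmGood i = Set.univ := Set.eq_univ_of_forall fun z => Or.inl h
    rw [this]
    exact dense_univ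
  · have hset : kgmGood i = {z | kgmTest i z = 0}ᶜ := by
      ext z
      simp only [kgmGood, Set.mem_setOf_eq, h, false_or, Set.mem_compl_iff]
    rw [hset, ← interior_eq_empty_iff_dense_compl]
    by_contra hne
    obtain ⟨z₀, hz₀⟩ := Set.nonempty_iff_ne_empty.mpr hne
    have hev : kgmTest i =ᶠ[nhds z₀] 0 := by
      filter_upwards [mem_interior_iff_mem_nhds.mp hz₀] with x hx
      simpa using hx
    have hzero := (kgm_analyticOnNhd_test i).eqOn_zero_of_preconnected_of_eventuallyEq_zero
      isPreconnected_univ (Set.mem_univ z₀) hev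
    exact h fun z' => by simpa using hzero (Set.mem_univ z')

/-- The very general points: the intersection of all good sets is dense in `ℂ⁵` (Baire). [folklore] -/
theorem kgm_dense_iInter_good : Dense (⋂ i : KgmIndex, kgmGood i) :=
  dense_iInter_of_isOpen kgm_isOpen_good kgm_dense_good

/-- The tube domain `{z | Im z ∈ ksPosCone}` is open in `ℂ⁵`. [folklore] -/
theorem kgm_isOpen_tube : IsOpen {z : Fin 5 → ℂ | (fun k => (z k).im) ∈ ksPosCone} :=
  FormalCycleCriterion.isOpen_ksPosCone.preimage
    (continuous_pi fun k => Complex.continuous_im.comp (continuous_apply k))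

end Baire

/-! ### §6 The very general member is Hodge-generic for rational constant forms -/

/-- **At a very general point, a rational form of type `(p,p)` is flat.** If `z₀` lies in every good
set and in the tube domain, and a rational constant form `ω` is of type `(p,p)` through a Kuga–Satake
period map of `z₀`, then `ω` is of type `(p,p)` through every Kuga–Satake period map of every point
of the tube domain. [cite: vanGeemenVerra2003QuaternionicPryms, §6.1]
[cite: LangeBirkenhake1992, §1.1.5 and §17.1 (very general members)] -/
theorem kgm_flat_of_generic {k p : ℕ} (hk : p + p = k) {ω : (Fin 8 ⊕ Fin 8 → ℝ) [⋀^Fin k]→L[ℝ] ℂ}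
    (hω : ω ∈ kgmRatForms k) {z₀ : Fin 5 → ℂ} (hgen : z₀ ∈ ⋂ i : KgmIndex, kgmGood i)
    (hz₀ : (fun k => (z₀ k).im) ∈ ksPosCone) {Φ₀ : (Fin 8 ⊕ Fin 8 → ℝ) ≃L[ℝ] (Fin 8 → ℂ)}
    (hΦ₀ : IsKSPeriodMap z₀ Φ₀)
    (htype : ComplexTorus.IsConstOfType p p
      (ω.compContinuousLinearMap (Φ₀.symm : (Fin 8 → ℂ) →L[ℝ] (Fin 8 ⊕ Fin 8 → ℝ)))) :
    ∀ z : Fin 5 → ℂ, (fun k => (z k).im) ∈ ksPosCone →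
      ∀ Φ : (Fin 8 ⊕ Fin 8 → ℝ) ≃L[ℝ] (Fin 8 → ℂ), IsKSPeriodMap z Φ →
        ComplexTorus.IsConstOfType p p
          (ω.compContinuousLinearMap (Φ.symm : (Fin 8 → ℂ) →L[ℝ] (Fin 8 ⊕ Fin 8 → ℝ))) := by
  intro z hz Φ hΦ
  have h0 : ∀ w, kgmDeriv ω z₀ w = 0 := (kgm_isConstOfType_iff hk ω hΦ₀ hz₀).1 htype
  -- every test function through `ω` vanishes at `z₀`, hence identically
  have hall : ∀ b : Fin k → Fin 8 ⊕ Fin 8, ∀ z', kgmDeriv ω z' (fun m => Pi.single (b m) (1 : ℝ)) = 0 := by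
    intro b z'
    have hmem := Set.mem_iInter.1 hgen ⟨k, ⟨ω, hω⟩, b⟩
    rcases hmem with hcase | hcase
    · exact hcase z'
    · exact absurd (h0 _) hcase
  exact (kgm_isConstOfType_iff hk ω hΦ hz).2
    (kgmDeriv_eq_zero_of_basis ω hΦ hz fun b => hall b z)

/-- **THE VERY GENERAL MEMBER OF THE KUGA–SATAKE FAMILY IS HODGE-GENERIC FOR RATIONAL CONSTANT FORMS.**
In every open subset of `ℂ⁵` meeting the tube domain `T = {Im z ∈ ksPosCone}` there is a point
`z₀ ∈ T` such that: every constant alternating form `ω` on `Λ_ℝ = ℝ⁸ ⊕ ℝ⁸` with rational values on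
the standard basis tuples, of any degree `k = 2p`, which is of type `(p,p)` on the member
`ℂ⁸/(ℤ⁸ ⊕ τ(z₀)ℤ⁸)` (through a Kuga–Satake period map of `z₀`), is of type `(p,p)` on EVERY member
through EVERY Kuga–Satake period map — i.e. is a flat Hodge form of the family. Proof: the type
condition through `Φ_z` is the vanishing of finitely many polynomial functions of the ten real
coordinates of `z` (the cleared derivation along `J_z = D⁻¹ N_z` on basis tuples); a polynomial
vanishing at a point outside the countable union of the proper zero sets vanishes identically
(identity principle), and Baire's theorem in `ℂ⁵` supplies such points densely. This is clause (i)
("Hodge-genericity") of `stub_kontsevichShadow` of line `birth` at the level of constant forms.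
[cite: vanGeemenVerra2003QuaternionicPryms, §6.1, Rem. 6.6] [cite: LangeBirkenhake1992, §17.1]
[cite: BochnakCosteRoy1998, §2.8] -/
theorem kontsevichTransferKS_exists_genericMember_forms (U : Set (Fin 5 → ℂ)) (hU : IsOpen U)
    (hUT : ∃ z ∈ U, (fun k => (z k).im) ∈ ksPosCone) :
    ∃ z₀ ∈ U, (fun k => (z₀ k).im) ∈ ksPosCone ∧
      ∀ (k p : ℕ), p + p = k → ∀ ω : (Fin 8 ⊕ Fin 8 → ℝ) [⋀^Fin k]→L[ℝ] ℂ,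
        (∀ v : Fin k → Fin 8 ⊕ Fin 8, ω (fun j => Pi.single (v j) (1 : ℝ)) ∈ Set.range (algebraMap ℚ ℂ)) →
        ∀ Φ₀ : (Fin 8 ⊕ Fin 8 → ℝ) ≃L[ℝ] (Fin 8 → ℂ), IsKSPeriodMap z₀ Φ₀ →
          ComplexTorus.IsConstOfType p p
            (ω.compContinuousLinearMap (Φ₀.symm : (Fin 8 → ℂ) →L[ℝ] (Fin 8 ⊕ Fin 8 → ℝ))) →
          ∀ z : Fin 5 → ℂ, (fun k => (z k).im) ∈ ksPosCone →
            ∀ Φ : (Fin 8 ⊕ Fin 8 → ℝ) ≃L[ℝ] (Fin 8 → ℂ), IsKSPeriodMap z Φ →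
              ComplexTorus.IsConstOfType p p
                (ω.compContinuousLinearMap (Φ.symm : (Fin 8 → ℂ) →L[ℝ] (Fin 8 ⊕ Fin 8 → ℝ))) := by
  obtain ⟨z₁, hz₁U, hz₁T⟩ := hUT
  obtain ⟨z₀, hz₀gen, hz₀U, hz₀T⟩ := kgm_dense_iInter_good.exists_mem_open (hU.inter kgm_isOpen_tube)
    ⟨z₁, hz₁U, hz₁T⟩
  exact ⟨z₀, hz₀U, hz₀T, fun k p hk ω hω Φ₀ hΦ₀ htype =>
    kgm_flat_of_generic hk hω hz₀gen hz₀T hΦ₀ htype⟩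

end Summit.HodgeConjecture.HodgeConjecture.Theorems

end
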